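import Mathlib.Analysis.Calculus.ContDiff.Defs
import Mathlib.MeasureTheory.Function.Jacobian
import Literature.NumberTheory.Transcendental.KZVolumeConjecture
import Literature.NumberTheory.Transcendental.KZLogCalculus
import HarnessLib
import HarnessLib.Audit
import HarnessLib.Audit.TribunalTags

/-!
# Strong-Hypothesis Library — summit `KontsevichZagierPeriods` (D-0034)

The REGISTRY of known strong hypotheses `H` (open conjectures with `H ⇒ P` landed or printed) and of
known EQUIVALENT REFORMULATIONS `E` (`E ↔ P` landed) for the single-problem summit
`KontsevichZagierPeriods` (problem `KontsevichZagierPeriods : Prop := Literature.Periods.KZPeriodConjecture`,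
`Summits/KontsevichZagierPeriods/KontsevichZagierPeriods/Statement.lean`: Conjecture 1 of Kontsevich–Zagier
2001, §1.2, in its two-representation RULES form over the calculus of moves of `KZCalculus.lean` — any two
integral representations of KZ's literal §1.1 shape with the same value are connected by finitely many
instances of rules 1), 2), 3)). Every entry carries
`@[strong_hypothesis "KontsevichZagierPeriods.KontsevichZagierPeriods"]`; the kernel tribunal
(`#h21_tribunal`, D-0033 T1 rule (a)) probes each registered `H` against a route crux `C` for `H → C`.
The bridges `H → P` / `H ↔ P` live summit-side in `Summits/KontsevichZagierPeriods/StrongHypotheses.lean`.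

Nothing already in the tree is restated: existing conjecture `def`s are tagged in place with
`attribute [strong_hypothesis …]`. The one NEW hypothesis (`GKZConjecture`) is an OPEN statement
(docstring `OPEN CONJECTURE — … [status: open]`, CONVENTIONS §4) carrying `@[conjecture]`; it is printed
to be at least as strong as the summit, so it is not dischargeable literature debt and has no `_holds`
to expect. This summit is peculiar: its statement is the most ELEMENTARY (rules-level) form of the period
conjecture, and every motivic form in print (formal periods, Grothendieck's period conjecture) is
"morally equivalent" to it but connected to the rules form by NO printed proof — so the library is
short: four landed equivalent criteria and one printed strictly-stronger hypothesis.

## Registry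

STRICTLY STRONGER than the summit (open):

| `H` | decl | status here | bridge (summit file) | source |
|---|---|---|---|---|
| geometric Kontsevich–Zagier conjecture (GKZ): `vol : K₀(CSA_{ℝalg}) → ℝ` is injective | `GKZConjecture` | NEW (stated here) | PRINTED: `Summit.KontsevichZagierPeriods.StrongHypotheses.GKZConjectureImpliesKontsevichZagierPeriods` | Cresson–Viu-Sos 2022, Conj. 1.1; "GKZ ⟹ KZ" ibid. (1.3) and Thm. 2.1 |

EQUIVALENT REFORMULATIONS (`E ↔ P`, all LANDED in the tree; each `E` is itself open):

| `E` | decl | status here | landed bridge | source |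
|---|---|---|---|---|
| two-representation form, all-semialgebraic endpoints | `Literature.NumberTheory.Transcendental.KZPeriodConjecture'` | existing, tagged | `kzPeriodConjecture'_iff_isRational` (`KZKernelConjectureForms`) | KZ 2001 §1.1 (remark) + §1.2 Conj. 1 |
| kernel form `ker eval = relations` (injectivity of evaluation on `FormalRep ⧸ relations`) | `Literature.NumberTheory.Transcendental.KZKernelConjecture` | existing, tagged | `kzKernelConjecture_iff_isRational` (`KZKernelConjectureForms`) | KZ 2001 §1.2; shape of HMS 2017 Conj. 13.2.1 |
| volume form: equal-volume compact top-dimensional semialgebraic sets are KZ-equivalent | `Literature.NumberTheory.Transcendental.KZ.volumeConjectureCompact` | existing, tagged | `KZ.kzPeriodConjecture'_iff_volumeConjectureCompact_holds` (`KZVolumeConjectureProofs`, over the discharged Viu-Sos reduction `KZ.semiCanonicalReduction_holds`) | Cresson–Viu-Sos 2022 §1 p. 326; Viu-Sos 2021 Thm. 1.1 |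
| kernel form of the LOGARITHMIC calculus (nine moves on representations with `log`-monomials) | `Literature.NumberTheory.Transcendental.KZlog.KernelConjecture` | existing, tagged | `KZlog.kzKernelConjecture_iff_kernelConjecture` (`KZLogCalculusProofs`, over `KZlog.Conservative_holds`) | in-tree extension of KZ 2001 §1.2 (route LiouvilleUnfolding); [folklore] |

## Deliberately NOT registered (and why)

* MOTIVIC / COHOMOLOGICAL FORMS — no printed proof connects them to the RULES form of the summit, and each is
  a PARAMETRISED PREDICATE over hypothesis structures (not a single closed `Prop`), some with PROVED junk
  instances, so a bridge would be either vacuous or a smuggled lemma: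
  - Kontsevich's formal period conjecture `Literature.NumberTheory.Transcendental.KontsevichPeriodConjecture R B σ`
    (`Sweep1.lean`; Kontsevich 1999 §4, HMS 2017 Def. 13.1.1 / Conj. 13.2.1, Ayoub 2014 Conj. 7). Printed
    RELATION: Kontsevich–Zagier 2001, §4.1 ASSERT (no proof) "Conjecture 1 from §1.2 is equivalent to —
    Conjecture. The evaluation homomorphism `𝒫 → P` is an isomorphism", and Huber–Müller-Stach 2017,
    Rem. 13.1.8 record that the fine print of this identification is unsettled; the tree's routes
    NoriTransfer (closed) / VeryGoodTransfer (open) carry the missing rules-level TRANSFER as cruxes and the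
    classical instance `FPCClassical` as a conjecture ITEM, and VeryGoodTransfer's header explains why a
    `∀ (classical datum)`-fact would be "summit-implied yet not provable by the mechanism". Direction in
    print: equivalence asserted, neither direction proved. Not tagged; bridge: none.
  - Grothendieck's period conjecture for all Nori motives `Literature.NoriMotivicInterface.GPCForAll N`
    (`NoriInterface.lean`; HMS 2017 Conj. 13.2.5). Printed RELATION: HMS 2017 Prop. 13.2.6, "Conjecture 13.2.5
    is true for all `M` iff Kontsevich–Zagier's Conjecture 13.2.1 holds" (both directions proved THERE, for the
    COHOMOLOGICAL Conj. 13.2.1, not the rules form); Ayoub 2014 Cor. 32: KZ ⟺ (GPC ∧ `𝒫_KZ` integral);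
    Ayoub 2014 Rem. 4: "the conjecture of Kontsevich–Zagier is stronger than the conjecture of Grothendieck".
    Over the interface `N` the tree PROVES `not_forall_gpcForAll` and `exists_gpcForAll` (junk models), so
    `(∀ N, N.GPCForAll) → C` holds for every `C`: registering it would poison the tribunal. Not tagged.
  - `Literature.AlgebraicGeometry.Motives.PeriodRealization.TorsorPeriodConjecture P σ n X₀` (GPC for ONE smooth
    projective `X₀`, motivated form; Bost–Charles 2014 Conj. 2.12) and `….AndrePeriodBound` (André's `≥` half):
    per-variety / pure / one-sided — WEAKER than or incomparable with the summit. Not tagged.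
* WEAKER than the summit (consequences, proved in tree from the kernel form): `KZ.PiLocalKernel`,
  `KZ.PiCancellation` (`KZProduct.lean`; only their CONJUNCTION is equivalent —
  `Theorems/AyoubSpecialisationAyoubThesisV2KernelPiSplit.lean`), `KZlog.Conservative` (now PROVED,
  `KZLogCalculusProofs`), the transcendence consequences vendored as barriers
  (`Literature/Barriers/KontsevichZagierPeriods/GrothendieckPeriodConjectureDependence*.lean`:
  odd zeta values, `2πi, log q`, non-CM elliptic periods), Schanuel-type statements, `ZetaFiveIrrational`, ….
* INCOMPARABLE: the exponential-calculus kernel conjecture `KZExp.KernelConjecture` (`KZExpCalculus.lean`;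
  implies the summit only together with `KZExp.Conservative`, itself a consequence of the summit);
  the standard conjectures and the Hodge conjecture (`Motives/…`) do NOT imply the summit in print or in tree.
* REFUTED in tree (would make every probe vacuous): `KZReg.KernelConjecture` (`KZRegCalculusProofs.not_kernelConjecture`).
* NOT REGISTERED ON PURPOSE although printed with a bridge: the **PL-GKZ conjecture** (Cresson–Viu-Sos 2022,
  Conj. 1.2, with Thm. 3.2 "PL-GKZ for all `d ≥ d₀` ⟹ KZ"). Its printed move set (rational-polyhedra scissors
  congruences + PL maps between rational polyhedra transporting the piecewise-algebraic volume forms) has NO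
  integrand-additivity and only piecewise-AFFINE changes of variables, so the additive functional
  "integral of the density over the set where it is locally constant" is invariant under both moves yet
  separates `([0,1]^d, 1)` from `([0,1]^d, 2x₁)` (equal integrals): as literally printed the hypothesis looks
  refutable, and a refutable `H` makes `H → C` vacuous. Recorded as a follow-up for a refuter / barrier file
  (vocabulary exists: `Literature.Barriers.KontsevichZagierPeriods.PL.IsRationalPolyhedron`, `IsPLMapOn`).
* ROUTE CRITERIA (`Theses` decls with landed `… ↔ KontsevichZagierPeriods`): they are cruxes, found by the
  tribunal's own scan of `Summits/…/Theorems`, never tagged here (e.g. `xMapKernel_iff_summit`,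
  `spArcLifting_iff_summit`, `kernelForm_iff_summit`, `logKernelConjecture_iff_summit`,
  `volumeForm_iff_kontsevichZagierPeriods`, `sectorComplement_iff_summit`, `realArcKernel_iff_kontsevichZagierPeriods`,
  `reductionRigidity_iff_kontsevichZagierPeriods`, `sectorToKernel_iff_kontsevichZagierPeriods`,
  `islandComplement_iff_kontsevichZagierPeriods`).

## Not yet typeable

* GPC for all (mixed) Nori motives over `ℚ̄` as a CONSTRUCTED statement (HMS 2017 Conj. 13.2.5 for the genuine
  `MM_Nori(ℚ̄)`; Ayoub 2014 Conj. 21 + Cor. 28/32): needs Nori's diagram category / a Tannakian formalism and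
  the motivic Galois group with its dimension (Mathlib has no linear algebraic groups); the tree has only the
  interface `NoriMotivicInterface`.
* André's generalized period conjecture `trdeg_ℚ k(periods(M)) ≥ dim G_mot(M)` for MIXED motives over an
  arbitrary `k ⊂ ℂ` (André 2004 §23.4; Bakker–Tsimerman 2025 Conj. 1.2): needs mixed motives; the tree has the
  pure/motivated per-variety predicate `AndrePeriodBound` only.
* Ayoub's "compact presentation" of the abstract period ring (Ayoub 2014, Def. 10 / Prop. 11 / Rem. 13:
  `𝒫 = (𝒪_alg(𝔻̄^∞) ⧸ ⟨∂f/∂zᵢ − f|_{zᵢ=1} + f|_{zᵢ=0}⟩)[2πi⁻¹] → ℂ` injective): the vocabulary now exists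
  (`AyoubRel.Oan`, `intC`, `relAC`, `kSpan` in `AyoubPeriodSeries.lean`), but the RING structure of `𝒫^eff`
  (concatenation-of-variables product on the direct limit) and its localisation are not in the tree, and
  Prop. 11 (the identification with `𝒫_KZ`) is proved in print only through Ayoub's and Nori's motivic Galois
  groups — again a cohomological form with no printed passage to the rules form. Its KZ-calculus transcription
  is already summit-side (`KZ.PiLocalKernel ∧ KZ.PiCancellation`, route AyoubSpecialisation).

## Sources (all keys in `lean/references.bib`)

[KontsevichZagier2001] §1.1–1.2 (Conjecture 1), §4.1; [CressonViusos2022] §1 (pp. 325–327: the volume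
conjecture, Conj. 1.1 GKZ, (1.3) "GKZ ⟹ KZ", Conj. 1.2 PL-GKZ), §2.2 (pp. 329–330: `CSA_{ℝalg}`, relations
(2.3)–(2.6), Rem. 2.2, `vol`), Thm. 2.1 (p. 331), §3.2 (Prop. 3.1, Thm. 3.2); [ViuSos2021] Thm. 1.1;
[HuberMullerStachPeriods2017] Rem. 13.1.8, Conj. 13.2.1, Conj. 13.2.5, Prop. 13.2.6; [Ayoub2014] Rem. 4,
Def. 6, Conj. 7, Def. 10, Prop. 11, Rem. 13, Conj. 21, Cor. 28, Cor. 32; [Kontsevich1999] §4;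
[HuberWustholz2022] Prologue; [BochnakCosteRoy1998] §2.1–2.2 (semialgebraic sets and maps; dimension).

## Design notes (readings fixed for `GKZConjecture`)

* Coefficients. Cresson–Viu-Sos work with semialgebraic sets "with coefficients in `ℝ_alg`"; real algebraic
  numbers are `∅`-definable in the real closed field `ℝ`, so `ℝ_alg`-semialgebraic = `ℚ`-semialgebraic
  (`Literature.ModelTheory.ExponentialFields.IsSemialgebraic ℚ`), the notion of `KZCalculus.lean`.
* Generators. `CSA^d_{ℝalg}` = "compact `d`-dimensional semi-algebraic sets in `ℝ^d`" (§2.2 (2.2), `d ≥ 1`;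
  Rem. 2.2 (2): the point `ℝ⁰` is excluded on purpose): rendered by the `Prop`-structure `IsCSA d K` (`0 < d`, `IsCompact K`,
  `(interior K).Nonempty`, `IsSemialgebraic ℚ K`) ("`d`-dimensional" ⟺ non-empty interior for a semialgebraic
  subset of `ℝ^d`; the same reading as the tree's `KZ.volumeConjectureCompact`). The empty set (a member of
  `CSA` in print, class `0`) is omitted from the generators; nothing changes.
* Scissors (2.3): "`codim(K ∩ K') ≥ 1`" is rendered `volume (K ∩ K') = 0` — for semialgebraic sets,
  dimension `< d` ⟺ empty interior ⟺ Lebesgue-null (BCR §2.8) — which is literally the side condition of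
  KZ's move (1a) `KZ.domainAddRel`.
* Volume-preserving maps (2.4): "`f : U → V` an algebraic diffeomorphism [graph semialgebraic, footnote 1]
  between open semialgebraic sets, `K ⊂ U`, `det(Jac(f)) = 1`" is rendered: `U` open `ℚ`-semialgebraic with
  `K ⊆ U`, `f` `ℚ`-semialgebraic on `U` (`IsSemialgebraicMapOn`), injective and `C¹` on `U` with
  `det (fderiv ℝ f x) = 1` on `U`; then `V := f '' U` is open and `f : U → V` a `C¹`-diffeomorphism (inverse
  function theorem), so nothing is lost but the regularity class, read as `C¹` — the class in which the paper
  itself applies the rule (Prop. 3.1 (2), via Ohmoto–Shiota `C¹` triangulations) and more than KZ's rule (2)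
  asks (`KZ.changeOfVariablesRel`: differentiable and injective on the domain). A `C^∞`/Nash reading gives a
  formally STRONGER hypothesis implying this one, so the printed bridge GKZ ⟹ KZ is unaffected.
* Product relations: (2.5) `[K × K'] = [K]·[K']` DEFINES the ring structure of `K₀` (it is not a relation of
  the additive group); the flattening relation (2.6) `[K × Iⁿ] = [K]`, `I = [0,1]`, IS one, rendered with the
  `Iⁿ`-coordinates appended LAST (`cylinder K n ⊆ ℝ^{d+n}`, `Fin.castAdd` / `Fin.natAdd`).
* The conjecture is stated in KERNEL form on the free abelian group (`gkzVol x = 0 → x ∈ gkzRelations`), i.e.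
  injectivity of `vol` on `K₀(CSA_{ℝalg}) = GKZGroup ⧸ gkzRelations` ("Equivalently, … the morphism
  `vol : K₀(CSA_{ℝalg}) → 𝒫_kz^ℝ` is injective", Conj. 1.1), exactly as `KZKernelConjecture` renders Conjecture 1.
  Soundness (`gkzRelations ≤ ker gkzVol`) is true (additivity of Lebesgue measure, the change-of-variables
  formula with `|det| = 1`, Fubini) and deliberately not proved here (registry file, no new mathematics).
-/

noncomputable section

/-! ## Existing conjecture `def`s, tagged in place (no restatement) -/

attribute [strong_hypothesis "KontsevichZagierPeriods.KontsevichZagierPeriods"]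
  Literature.NumberTheory.Transcendental.KZPeriodConjecture'
  Literature.NumberTheory.Transcendental.KZKernelConjecture
  Literature.NumberTheory.Transcendental.KZ.volumeConjectureCompact
  Literature.NumberTheory.Transcendental.KZlog.KernelConjecture

namespace Literature.StrongHypotheses.KontsevichZagierPeriods

open _root_.MeasureTheory _root_.Set
open Literature.ModelTheory.ExponentialFields (IsSemialgebraic)
open Literature.NumberTheory.Transcendental (IsSemialgebraicMapOn)

/-! ## The geometric Kontsevich–Zagier conjecture of Cresson–Viu-Sos (newly stated) -/

/-- `IsCSA d K`: `K ⊆ ℝ^d` is a member of `CSA^d_{ℝalg}`, the "collection of compact `d`-dimensional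
semi-algebraic sets in `ℝ^d`" of Cresson–Viu-Sos, for `d ≥ 1` (their (2.2) ranges over `d ≥ 1`; Rem. 2.2 (2)
excludes the point `ℝ⁰`): `0 < d`, `K` compact, with non-empty interior (= of dimension `d`), and
`ℚ`-semialgebraic (= `ℝ_alg`-semialgebraic, see the module docstring). A `Prop`-valued structure (a
predicate on `(d, K)`, not a named fact). [cite: CressonViusos2022, §2.2 (2.2) and Rem. 2.2 (2)] -/
structure IsCSA (d : ℕ) (K : Set (Fin d → ℝ)) : Prop where
  /-- the ambient dimension is positive (points are excluded, Rem. 2.2 (2)) -/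
  pos : 0 < d
  /-- `K` is compact -/
  isCompact : IsCompact K
  /-- `K` is top-dimensional: non-empty interior -/
  interior_nonempty : (interior K).Nonempty
  /-- `K` is `ℚ`-semialgebraic -/
  isSemialgebraic : IsSemialgebraic ℚ K

/-- The generators of `K₀(CSA_{ℝalg})`: all compact top-dimensional `ℚ`-semialgebraic sets, of all ambient
dimensions `d ≥ 1` (`CSA_{ℝalg} = ⋃_{d ≥ 1} CSA^d_{ℝalg}`, Cresson–Viu-Sos (2.2)).
[cite: CressonViusos2022, §2.2 (2.2)] -/
abbrev CSA : Type := Σ d : ℕ, {K : Set (Fin d → ℝ) // IsCSA d K}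

/-- The free abelian group on `CSA_{ℝalg}` ("Let `(K₀(CSA_{ℝalg}), +)` be the free abelian group generated by
the classes `[K]`, with `K ∈ CSA_{ℝalg}`, modulo the relations …" — the relations are `gkzRelations`; the
quotient `GKZGroup ⧸ gkzRelations` is their `K₀(CSA_{ℝalg})`). [cite: CressonViusos2022, §2.2] -/
abbrev GKZGroup : Type := FreeAbelianGroup CSA

/-- The generator `[K] ∈ GKZGroup` of a compact top-dimensional semialgebraic set `K ⊆ ℝ^d`.
[cite: CressonViusos2022, §2.2] -/
def csaOf {d : ℕ} (K : Set (Fin d → ℝ)) (h : IsCSA d K) : GKZGroup :=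
  FreeAbelianGroup.of ⟨d, K, h⟩

/-- The volume morphism `vol : K₀(CSA_{ℝalg}) → ℝ`, `vol([K]) = vol_d(K)` for `K ∈ CSA^d_{ℝalg}` (Lebesgue
measure of `ℝ^d`; finite since `K` is compact), as the additive extension to the free abelian group
(it factors through the relations by soundness, not needed for the statement).
[cite: CressonViusos2022, §2.2 (p. 330, the ring morphism vol)] -/
def gkzVol : GKZGroup →+ ℝ :=
  FreeAbelianGroup.lift fun K : CSA => (volume (K.2.1 : Set (Fin K.1 → ℝ))).toReal

/-- `vol` of a generator is the volume of the set. [cite: CressonViusos2022, §2.2 (p. 330)] -/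
@[simp] theorem gkzVol_csaOf {d : ℕ} (K : Set (Fin d → ℝ)) (h : IsCSA d K) :
    gkzVol (csaOf K h) = (volume K).toReal :=
  FreeAbelianGroup.lift_apply_of _ _

/-- The cylinder `K × Iⁿ ⊆ ℝ^{d+n}` over `K ⊆ ℝ^d`, `I = [0, 1]`, with the `n` unit-interval coordinates
appended last (flattening relation (2.6)). [cite: CressonViusos2022, §2.2 (2.6)] -/
def cylinder {d : ℕ} (K : Set (Fin d → ℝ)) (n : ℕ) : Set (Fin (d + n) → ℝ) :=
  {z | (fun i : Fin d => z (Fin.castAdd n i)) ∈ K ∧ ∀ j : Fin n, z (Fin.natAdd d j) ∈ Icc (0 : ℝ) 1}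

/-- **Semi-algebraic scissors congruences** (2.3): "If `K, K' ∈ CSA^d_{ℝalg}` such that
`codim(K ∩ K') ≥ 1`, then `[K ∪ K'] = [K] + [K']`" — the generators `[K ∪ K'] − [K] − [K']`, the codimension
condition read as `volume (K ∩ K') = 0` (equivalent for semialgebraic sets; the side condition of KZ's move
(1a)). [cite: CressonViusos2022, §2.2 (2.3)] -/
def scissorsRel : Set GKZGroup :=
  {x | ∃ (d : ℕ) (K K' : Set (Fin d → ℝ)) (hK : IsCSA d K) (hK' : IsCSA d K') (hU : IsCSA d (K ∪ K')),
    volume (K ∩ K') = 0 ∧ x = csaOf (K ∪ K') hU - csaOf K hK - csaOf K' hK'}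

/-- **Algebraic volume-preserving maps** (2.4): "If there exist `U, V ⊂ ℝ^d` open semi-algebraic sets and
`f : U → V` an algebraic diffeomorphism such that `K ⊂ U` and `det(Jac(f)) = 1`, then `[K] = [f(K)]`"
(footnote 1: `f` is (semi-)algebraic if its graph is) — the generators `[K] − [f(K)]`, with `U` open
`ℚ`-semialgebraic, `K ⊆ U`, `f` `ℚ`-semialgebraic, injective and `C¹` on `U` with Jacobian determinant `1`
on `U` (so `V = f(U)` is open and `f : U → V` a `C¹`-diffeomorphism; readings in the module docstring).
[cite: CressonViusos2022, §2.2 (2.4)] -/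
def volumePreservingRel : Set GKZGroup :=
  {x | ∃ (d : ℕ) (K U : Set (Fin d → ℝ)) (f : (Fin d → ℝ) → (Fin d → ℝ)) (hK : IsCSA d K)
      (hfK : IsCSA d (f '' K)),
    IsOpen U ∧ IsSemialgebraic ℚ U ∧ K ⊆ U ∧ IsSemialgebraicMapOn ℚ U f ∧ InjOn f U ∧
    ContDiffOn ℝ 1 f U ∧ (∀ p ∈ U, (fderiv ℝ f p).det = 1) ∧
    x = csaOf K hK - csaOf (f '' K) hfK}

/-- **Flattening relation** (2.6): "For any `K ∈ CSA^d_{ℝalg}` and `n ≥ 0`, `[K × Iⁿ] = [K]`" (`I = [0,1]`;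
`[I]` is the unit of the ring `K₀(CSA_{ℝalg})`, Rem. 2.2 (1)) — the generators `[K × Iⁿ] − [K]`.
[cite: CressonViusos2022, §2.2 (2.6)] -/
def flatteningRel : Set GKZGroup :=
  {x | ∃ (d n : ℕ) (K : Set (Fin d → ℝ)) (hK : IsCSA d K) (hC : IsCSA (d + n) (cylinder K n)),
    x = csaOf (cylinder K n) hC - csaOf K hK}

/-- The relations of `K₀(CSA_{ℝalg})`: the subgroup generated by the semi-algebraic scissors congruences
(2.3), the algebraic volume-preserving maps (2.4) and the flattening relations (2.6) — the "GKZ-rules"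
(the product (2.5) is the ring structure, not a relation). [cite: CressonViusos2022, §2.2 (2.3)–(2.6)] -/
def gkzRelations : AddSubgroup GKZGroup :=
  AddSubgroup.closure (scissorsRel ∪ volumePreservingRel ∪ flatteningRel)

/-- OPEN CONJECTURE — the **geometric Kontsevich–Zagier conjecture (GKZ-conjecture)** of J. Cresson and
J. Viu-Sos, *On the equality of periods of Kontsevich–Zagier*, J. Théor. Nombres Bordeaux 34 (2022), Conj. 1.1
(p. 326): "Let `K₁, K₂` be two compact top-dimensional semi-algebraic sets in `ℝ^d` such that
`vol_d(K₁) = vol_d(K₂)`. Then, we can transform `K₁` into `K₂` only using the following geometric operations: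
semi-algebraic scissors congruences, algebraic volume-preserving maps respecting the KZ-rules, (Cartesian)
product relations. Equivalently, let `K₀(CSA_{ℝalg})` be the Grothendieck ring of top-dimensional compact
semi-algebraic sets modulo decompositions and volume-preserving transformations. Then … the morphism
`vol : K₀(CSA_{ℝalg}) → 𝒫_kz^ℝ` (associating the class `[K]` to the volume of `K`) is injective." Stated here
in the "equivalently" (injectivity) form, as a kernel statement on the free abelian group: every formal
`ℤ`-combination of compact top-dimensional `ℚ`-semialgebraic sets with total signed volume `0` lies in the
subgroup generated by the GKZ-rules (2.3), (2.4), (2.6). Printed to be STRICTLY STRONGER than (i.e. to imply)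
Conjecture 1 of Kontsevich–Zagier: "(1.3) GKZ ⟹ KZ" and "Theorem 2.1. The GKZ-conjecture implies the
KZ-conjecture" (ibid. p. 326 and p. 331; via Viu-Sos' semi-canonical reduction, in tree
`KZ.semiCanonicalReduction_holds`, and the fact that each GKZ-rule is an instance of the KZ-rules) — bridge
PRINTED, summit file. Open: neither proved nor refuted ("A negative answer for the GKZ-conjecture will be also
very interesting in order to determine possible obstructions or counterexamples for the KZ-conjecture",
p. 331; §4 of the paper discusses evidence and obstructions). Readings (coefficients `ℝ_alg` = `ℚ`,
"`d`-dimensional" = non-empty interior, "`codim ≥ 1`" = Lebesgue-null, "algebraic diffeomorphism" = `C¹`) are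
fixed in the module docstring. [cite: CressonViusos2022, Conj. 1.1 (p. 326) with §2.2 (2.3)–(2.6)] [status: open] -/
@[conjecture, strong_hypothesis "KontsevichZagierPeriods.KontsevichZagierPeriods"]
def GKZConjecture : Prop :=
  ∀ x : GKZGroup, gkzVol x = 0 → x ∈ gkzRelations

/-- Unfolding: `GKZConjecture` is `ker vol ≤ gkzRelations`. [cite: CressonViusos2022, Conj. 1.1] -/
theorem gkzConjecture_iff_ker_le : GKZConjecture ↔ gkzVol.ker ≤ gkzRelations :=
  ⟨fun h x hx => h x ((AddMonoidHom.mem_ker).1 hx), fun h _ hx => h ((AddMonoidHom.mem_ker).2 hx)⟩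

end Literature.StrongHypotheses.KontsevichZagierPeriods
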